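import Mathlib
import Literature.Analysis.FunctionSpaces.ContDiffHolderCompactInclusion
import Literature.Analysis.FunctionSpaces.ContDiffHolderComposition
import Summits.SmoothPoincare4.SmoothPoincare4.Theorems.SullivanDualTameOrBrodyR4CoreAChart
import Summits.SmoothPoincare4.SmoothPoincare4.Theorems.SullivanDualTameOrBrodyR4CoreAOperatorsHigher
import Summits.SmoothPoincare4.SmoothPoincare4.Theorems.SullivanDualTameOrBrodyR4CoreANonlinear
import Summits.SmoothPoincare4.SmoothPoincare4.Theorems.SullivanDualTameOrBrodyR4CoreAKernel

/-!
# CORE-A of crux `TameOrBrodyR4` (stmt-SmoothPoincare4-7826), line `Sketch`: the vorticity data of a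
# chart at every Hölder order and the vorticity map pointwise (lead c6, layer A7a)

From chart data `𝒞 : ChartData J R P Q eP eQ b₀ u₀` (`…CoreAChart.lean`) and an order `k` we build
the `VorticityData k r` of `…CoreANonlinear.lean` (cut-off coefficient fields as members, the
constant sections `β ↦ (0, β)`, the order-`k` cut-off Cauchy transform of
`…CoreAOperatorsHigher.lean`), compute the FULL derivative of the abstract vorticity map at the
origin (`VorticityData.hasFDerivAt_G_zero`), identify its zeroth-order field (`S₁_apply`,
`S₁fun_eq_half_S`: on the support of `χ` it is `½ S`), and unfold the vorticity map of the chart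
pointwise (`ChartData.G_apply_eq`, registered as `helper_chartVorticityApply`): this is the
"zero equation" consumed by `helper_zerosAnalytic` / produced by `helper_memberToZero`.
-/

-- the registered namespace `Summit.SmoothPoincare4.SmoothPoincare4.…` repeats a component
set_option linter.dupNamespace false
set_option maxSynthPendingDepth 3

noncomputable section

open scoped ContDiff Topology NNReal
open Filter Set Function Metric Literature.Analysis.Complex Literature.Analysis.FunctionSpaces
  Literature.Analysis.Calculus Literature.Geometry.Symplectic

namespace Summit.SmoothPoincare4.SmoothPoincare4.Cruxes.TameOrBrodyR4.Sketch

namespace CoreA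

/-- Local notation for the model space `ℝ⁴ = EuclideanSpace ℝ (Fin 4)`. -/
local notation "E4" => EuclideanSpace ℝ (Fin 4)
/-- Local notation for the complex model plane `ℂ²`. -/
local notation "F2" => ℂ × ℂ

/-! ### Members from smooth compactly supported functions; constant sections -/

section Members

variable {V : Type} [NormedAddCommGroup V] [NormedSpace ℝ V] {k : ℕ} {r : ℝ≥0}

/-- A smooth compactly supported function as a member of `C^{k,r}_b`. -/
def mkc (hr : r ≤ 1) (f : ℂ → V) (hf : ContDiff ℝ ∞ f) (hs : HasCompactSupport f) :
    ContDiffHolderFunction ℂ V k r :=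
  ⟨f, MemContDiffHolder.of_contDiff_of_hasCompactSupport hf hs hr⟩

/-- Pointwise formula for `mkc`. -/
@[simp] theorem mkc_apply (hr : r ≤ 1) (f : ℂ → V) (hf : ContDiff ℝ ∞ f) (hs : HasCompactSupport f)
    (x : ℂ) : mkc (k := k) hr f hf hs x = f x := rfl

/-- Constant functions are members of every `C^{k,r}_b`. -/
theorem memContDiffHolder_const (c : V) : ∀ k : ℕ, MemContDiffHolder k r (fun _ : ℂ => c)
  | 0 => memContDiffHolder_zero_of_bounds continuous_const (fun _ => le_rfl)
      (C := 0) (show HolderWith 0 r (fun _ : ℂ => c) from fun x y => by simp)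
  | k + 1 => by
      rw [memContDiffHolder_succ_iff]
      refine ⟨contDiff_const, eSupNorm_lt_top_iff.2 ⟨‖c‖, fun _ => le_rfl⟩, ?_⟩
      have : fderiv ℝ (fun _ : ℂ => c) = 0 := by funext x; simp
      rw [this]
      exact memContDiffHolder_zero_fun

variable [CompleteSpace V]

/-- The constant-section operator `c ↦ (x ↦ c)` as a bounded operator `V →L[ℝ] C^{k,r}_b(ℂ, V)`
(continuity by closed graph). -/
def constCLM : V →L[ℝ] ContDiffHolderFunction ℂ V k r :=
  ContDiffHolderFunction.clmOfContinuousEval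
    { toFun := fun c => ⟨fun _ => c, memContDiffHolder_const c k⟩
      map_add' := fun c c' => by apply ContDiffHolderFunction.ext; intro x; rfl
      map_smul' := fun a c => by apply ContDiffHolderFunction.ext; intro x; rfl }
    fun _ => by change Continuous fun u : V => u; exact continuous_id'

/-- Pointwise formula for `constCLM`. -/
@[simp] theorem constCLM_apply (c : V) (x : ℂ) : constCLM (k := k) (r := r) c x = c := rfl

end Members

/-! ### The full derivative of the vorticity map at the origin -/

namespace VorticityData

variable {k : ℕ} {r : ℝ≥0} (hr : r ≤ 1) (D : VorticityData k r)

/-- The full linearisation of `𝒢` at `(0, 0)`: `(β', h) ↦ h + χ • (S₁ · V₀(β', h))`. -/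
def Lfull : ℂ × ContDiffHolderFunction ℂ F2 k r →L[ℝ] ContDiffHolderFunction ℂ F2 k r :=
  ContinuousLinearMap.snd ℝ ℂ _ +
    (ContDiffHolderFunction.coeffCLM hr D.χ D.hχ D.hχs).comp ((app hr (D.S₁ hr)).comp (D.V₀ hr))

/-- Formula for `Lfull`. -/
@[simp] theorem Lfull_apply (p : ℂ × ContDiffHolderFunction ℂ F2 k r) :
    D.Lfull hr p = p.2 + ContDiffHolderFunction.coeffCLM hr D.χ D.hχ D.hχs
      (app hr (D.S₁ hr) (D.V₀ hr p)) := rfl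

/-- **The full derivative of `𝒢` at `(0, 0)` is `Lfull`.** -/
theorem hasFDerivAt_G_zero : HasFDerivAt (D.G hr) (D.Lfull hr) (0, 0) := by
  have hV : HasFDerivAt (fun p : ℂ × ContDiffHolderFunction ℂ F2 k r => (D.V₀ hr p, D.V₁ p))
      ((D.V₀ hr).prod D.V₁) (0, 0) :=
    (D.V₀ hr).hasFDerivAt.prodMk D.V₁.hasFDerivAt
  have h00 : (D.V₀ hr (0, 0), D.V₁ (0, 0)) = (0, 0) := by
    simp [VorticityData.V₀, VorticityData.V₁]
  have hΦ := D.hasFDerivAt_Φ_zero hr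
  rw [← h00] at hΦ
  have hc := (ContDiffHolderFunction.coeffCLM hr D.χ D.hχ D.hχs).hasFDerivAt.comp
    ((0 : ℂ), (0 : ContDiffHolderFunction ℂ F2 k r)) (hΦ.comp ((0 : ℂ), (0 : _)) hV)
  have htot := (hasFDerivAt_snd (𝕜 := ℝ) (p := ((0 : ℂ), (0 : ContDiffHolderFunction ℂ F2 k r)))).add hc
  have hG : D.G hr = fun p : ℂ × ContDiffHolderFunction ℂ F2 k r =>
      p.2 + ContDiffHolderFunction.coeffCLM hr D.χ D.hχ D.hχs (D.Φ hr (D.V₀ hr p, D.V₁ p)) := rfl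
  rw [hG]
  refine htot.congr_fderiv ?_
  refine ContinuousLinearMap.ext fun q => ?_
  simp only [add_apply, ContinuousLinearMap.comp_apply, ContinuousLinearMap.coe_snd',
    ContinuousLinearMap.coe_fst', ContinuousLinearMap.prod_apply, Lfull_apply]

end VorticityData

/-! ### The vorticity data of a chart -/

namespace ChartData

variable {J : E4 → E4 →L[ℝ] E4} {R : ℝ} {P Q : E4 →L[ℝ] ℂ} {eP eQ : ℂ →L[ℝ] E4} {b₀ : ℂ}
  {u₀ : ℂ → E4} (𝒞 : ChartData J R P Q eP eQ b₀ u₀)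
  {r : ℝ≥0} (hr0 : 0 < r) (hr1 : r < 1) (hJs : ContDiff ℝ ∞ J) (hu₀s : ContDiff ℝ ∞ u₀)

/-- The radius of the cut-off Cauchy transform: `χ₁` vanishes off the `ρ₁ + 3`-disc. -/
theorem hρT : 0 < 𝒞.ρ₁ + 3 := by linarith [𝒞.hρ₁]

include hJs hu₀s in
/-- `A` is smooth. -/
theorem contDiff_A : ContDiff ℝ ∞ 𝒞.A := by
  unfold ChartData.A
  have h1 : ContDiff ℝ ∞ fun ξ => fderiv ℝ 𝒞.Ψ ξ (1 : ℂ) :=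
    (𝒞.hΨs.fderiv_right le_rfl).clm_apply contDiff_const
  have h2 : ContDiff ℝ ∞ fun ξ => fderiv ℝ 𝒞.Ψ ξ Complex.I :=
    (𝒞.hΨs.fderiv_right le_rfl).clm_apply contDiff_const
  exact 𝒞.hΨinvs.clm_comp (h1.add ((hJs.comp hu₀s).clm_comp h2))

/-- The smooth function underlying the zeroth-order field `S₁` of the abstract linearisation:
`S₁fun x = (χ₁ x/2) • A x + ((χ₁ x/2) • Ψ⁻¹ x) ∘ (y ↦ DJ(χ₁ x • u₀ x) y (χ₁ x • ∂_y u₀ x)) ∘ (χ₁ x • Ψ x)`. -/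
def S₁fun (x : ℂ) : F2 →L[ℝ] F2 :=
  (𝒞.χ₁ x / 2) • 𝒞.A x +
    ((𝒞.χ₁ x / 2) • 𝒞.Ψinv x).comp
      (((fderiv ℝ J (𝒞.χ₁ x • u₀ x)).flip (𝒞.χ₁ x • fderiv ℝ u₀ x Complex.I)).comp
        (𝒞.χ₁ x • 𝒞.Ψ x))

include hJs hu₀s in
/-- `S₁fun` is smooth. -/
theorem contDiff_S₁fun : ContDiff ℝ ∞ 𝒞.S₁fun := by
  unfold S₁fun
  have hχ₁2 : ContDiff ℝ ∞ fun x => 𝒞.χ₁ x / 2 := 𝒞.hχ₁.div_const 2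
  refine (hχ₁2.smul (𝒞.contDiff_A hJs hu₀s)).add ?_
  refine (hχ₁2.smul 𝒞.hΨinvs).clm_comp (ContDiff.clm_comp ?_ (𝒞.hχ₁.smul 𝒞.hΨs))
  have hDJ : ContDiff ℝ ∞ fun x => fderiv ℝ J (𝒞.χ₁ x • u₀ x) :=
    (hJs.fderiv_right le_rfl).comp (𝒞.hχ₁.smul hu₀s)
  have hdy : ContDiff ℝ ∞ fun x => 𝒞.χ₁ x • fderiv ℝ u₀ x Complex.I :=
    𝒞.hχ₁.smul ((hu₀s.fderiv_right le_rfl).clm_apply contDiff_const)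
  -- `x ↦ (T x).flip (v x)` is smooth: `flip` is a continuous linear isometry, then `clm_apply`
  have hflip : ContDiff ℝ ∞ fun x => (fderiv ℝ J (𝒞.χ₁ x • u₀ x)).flip :=
    (ContinuousLinearMap.flipₗᵢ ℝ E4 E4 E4).contDiff.comp hDJ
  exact hflip.clm_apply hdy

/-- `S₁fun` has compact support (factor `χ₁`). -/
theorem hasCompactSupport_S₁fun : HasCompactSupport 𝒞.S₁fun := by
  refine hasCompactSupport_of_eq_zero (ρ := 𝒞.ρ₁ + 3) fun z hz => ?_
  simp [S₁fun, 𝒞.hχ₁_zero z hz]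

variable {k : ℕ}

/-- **The vorticity data of the chart at order `k`.** -/
def vorticity (k : ℕ) : VorticityData k r where
  J := J
  hJ := hJs
  A₁ := mkc hr1.le (fun x => (𝒞.χ₁ x / 2) • 𝒞.A x)
    ((𝒞.hχ₁.div_const 2).smul (𝒞.contDiff_A hJs hu₀s))
    (hasCompactSupport_of_eq_zero (ρ := 𝒞.ρ₁ + 3) fun z hz => by simp [𝒞.hχ₁_zero z hz])
  Ψ₁ := mkc hr1.le (fun x => 𝒞.χ₁ x • 𝒞.Ψ x) (𝒞.hχ₁.smul 𝒞.hΨs)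
    (hasCompactSupport_of_eq_zero (ρ := 𝒞.ρ₁ + 3) fun z hz => by simp [𝒞.hχ₁_zero z hz])
  dyΨ₁ := mkc hr1.le (fun x => 𝒞.χ₁ x • fderiv ℝ 𝒞.Ψ x Complex.I)
    (𝒞.hχ₁.smul ((𝒞.hΨs.fderiv_right le_rfl).clm_apply contDiff_const))
    (hasCompactSupport_of_eq_zero (ρ := 𝒞.ρ₁ + 3) fun z hz => by simp [𝒞.hχ₁_zero z hz])
  Ψinv₁ := mkc hr1.le (fun x => (𝒞.χ₁ x / 2) • 𝒞.Ψinv x) ((𝒞.hχ₁.div_const 2).smul 𝒞.hΨinvs)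
    (hasCompactSupport_of_eq_zero (ρ := 𝒞.ρ₁ + 3) fun z hz => by simp [𝒞.hχ₁_zero z hz])
  u₁ := mkc hr1.le (fun x => 𝒞.χ₁ x • u₀ x) (𝒞.hχ₁.smul hu₀s)
    (hasCompactSupport_of_eq_zero (ρ := 𝒞.ρ₁ + 3) fun z hz => by simp [𝒞.hχ₁_zero z hz])
  dyu₁ := mkc hr1.le (fun x => 𝒞.χ₁ x • fderiv ℝ u₀ x Complex.I)
    (𝒞.hχ₁.smul ((hu₀s.fderiv_right le_rfl).clm_apply contDiff_const))
    (hasCompactSupport_of_eq_zero (ρ := 𝒞.ρ₁ + 3) fun z hz => by simp [𝒞.hχ₁_zero z hz])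
  χ := 𝒞.χ
  hχ := 𝒞.hχ
  hχs := 𝒞.hχs
  Cβ := (constCLM (k := k + 1) (r := r) (V := F2)).comp
    ((ContinuousLinearMap.inr ℝ ℂ ℂ : ℂ →L[ℝ] F2))
  𝒯 := cutTransformCLMk hr0 hr1 (cauchyTransformHolderApriori_of_lt_one F2 hr0 hr1) 𝒞.hχ₁ 𝒞.hχ₁s
    𝒞.hρT 𝒞.hχ₁_zero

/-- The `χ` of the vorticity data is the chart's `χ`. -/
@[simp] theorem vorticity_χ : (𝒞.vorticity hr0 hr1 hJs hu₀s k).χ = 𝒞.χ := rfl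

/-- The `J` of the vorticity data. -/
@[simp] theorem vorticity_J : (𝒞.vorticity hr0 hr1 hJs hu₀s k).J = J := rfl

/-- The cut-off Cauchy transform of the vorticity data. -/
theorem vorticity_𝒯 : (𝒞.vorticity hr0 hr1 hJs hu₀s k).𝒯 =
    cutTransformCLMk hr0 hr1 (cauchyTransformHolderApriori_of_lt_one F2 hr0 hr1) 𝒞.hχ₁ 𝒞.hχ₁s
      𝒞.hρT 𝒞.hχ₁_zero := rfl

/-- Pointwise formula for the cut-off Cauchy transform of the vorticity data. -/
@[simp] theorem vorticity_𝒯_apply (g : ContDiffHolderFunction ℂ F2 k r) (x : ℂ) :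
    (𝒞.vorticity hr0 hr1 hJs hu₀s k).𝒯 g x =
      cauchyTransformAlong (1 : ℂ) (fun w => 𝒞.χ₁ w • g w) x := rfl

/-- Pointwise formula for the constant sections of the vorticity data. -/
@[simp] theorem vorticity_Cβ_apply (β : ℂ) (x : ℂ) :
    (𝒞.vorticity hr0 hr1 hJs hu₀s k).Cβ β x = ((0 : ℂ), β) := rfl

/-- Field `A₁` of the vorticity data, pointwise. -/
@[simp] theorem vorticity_A₁_apply (x : ℂ) :
    (𝒞.vorticity hr0 hr1 hJs hu₀s k).A₁ x = (𝒞.χ₁ x / 2) • 𝒞.A x := rfl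

/-- Field `Ψ₁` of the vorticity data, pointwise. -/
@[simp] theorem vorticity_Ψ₁_apply (x : ℂ) :
    (𝒞.vorticity hr0 hr1 hJs hu₀s k).Ψ₁ x = 𝒞.χ₁ x • 𝒞.Ψ x := rfl

/-- Field `dyΨ₁` of the vorticity data, pointwise. -/
@[simp] theorem vorticity_dyΨ₁_apply (x : ℂ) :
    (𝒞.vorticity hr0 hr1 hJs hu₀s k).dyΨ₁ x = 𝒞.χ₁ x • fderiv ℝ 𝒞.Ψ x Complex.I := rfl

/-- Field `Ψinv₁` of the vorticity data, pointwise. -/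
@[simp] theorem vorticity_Ψinv₁_apply (x : ℂ) :
    (𝒞.vorticity hr0 hr1 hJs hu₀s k).Ψinv₁ x = (𝒞.χ₁ x / 2) • 𝒞.Ψinv x := rfl

/-- Field `u₁` of the vorticity data, pointwise. -/
@[simp] theorem vorticity_u₁_apply (x : ℂ) :
    (𝒞.vorticity hr0 hr1 hJs hu₀s k).u₁ x = 𝒞.χ₁ x • u₀ x := rfl

/-- Field `dyu₁` of the vorticity data, pointwise. -/
@[simp] theorem vorticity_dyu₁_apply (x : ℂ) :
    (𝒞.vorticity hr0 hr1 hJs hu₀s k).dyu₁ x = 𝒞.χ₁ x • fderiv ℝ u₀ x Complex.I := rfl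

/-- The abstract field `S₁` of the vorticity data is the smooth function `S₁fun`. -/
theorem S₁_apply (x : ℂ) : (𝒞.vorticity hr0 hr1 hJs hu₀s k).S₁ hr1.le x = 𝒞.S₁fun x := by
  refine ContinuousLinearMap.ext fun y => ?_
  simp only [VorticityData.S₁, vorticity, S₁fun, ContDiffHolderFunction.coe_add, Pi.add_apply,
    add_apply, cmp_apply, flipEval_apply, ContinuousLinearMap.comp_apply,
    ContDiffHolderFunction.compLeft_apply, mkc_apply, smul_apply,
    ContinuousLinearMap.flip_apply]

/-- **On the support of `χ`, `S₁fun = ½ S`.** -/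
theorem S₁fun_eq_half_S {x : ℂ} (hx : 𝒞.χ x ≠ 0) : 𝒞.S₁fun x = (1 / 2 : ℝ) • 𝒞.S x := by
  have h1 : 𝒞.χ₁ x = 1 := 𝒞.χ₁_eq_one_of_χ_ne_zero hx
  refine ContinuousLinearMap.ext fun y => ?_
  simp only [S₁fun, ChartData.S, ChartData.A, h1, one_smul, add_apply,
    ContinuousLinearMap.comp_apply, smul_apply,
    ContinuousLinearMap.flip_apply, ContinuousLinearMap.apply_apply, map_add, smul_add]

/-- On the support of `χ`, the abstract `S₁` is `½ S`. -/
theorem S₁_eq_half_S {x : ℂ} (hx : 𝒞.χ x ≠ 0) :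
    (𝒞.vorticity hr0 hr1 hJs hu₀s k).S₁ hr1.le x = (1 / 2 : ℝ) • 𝒞.S x := by
  rw [S₁_apply, 𝒞.S₁fun_eq_half_S hx]

/-! ### The vorticity map pointwise -/

/-- The underlying function of `W(β, g) = c_β + 𝒯 g`. -/
theorem coe_W (β : ℂ) (g : ContDiffHolderFunction ℂ F2 k r) :
    (((𝒞.vorticity hr0 hr1 hJs hu₀s k).W (β, g) : ContDiffHolderFunction ℂ F2 (k + 1) r) :
        ℂ → F2) =
      fun y => ((0 : ℂ), β) + cauchyTransformAlong (1 : ℂ) (fun w => 𝒞.χ₁ w • g w) y := by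
  funext y
  rfl

/-- **The vorticity map of the chart, pointwise** (the registered "zero equation" of the line):
with `W = (0, β) + T(χ₁ g)`,
`𝒢(β, g)(x) = g x + χ x • ½ • (A x (W x) + Ψ⁻¹ x ((J(u₀ x + Ψ x (W x)) - J(u₀ x))(∂_y u₀ x +
(∂_yΨ x)(W x) + Ψ x (∂_y W x))))`. -/
theorem G_apply_eq (β : ℂ) (g : ContDiffHolderFunction ℂ F2 k r) (x : ℂ) :
    (𝒞.vorticity hr0 hr1 hJs hu₀s k).G hr1.le (β, g) x =
      g x + 𝒞.χ x • (1 / 2 : ℝ) •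
        (𝒞.A x (((0 : ℂ), β) + cauchyTransformAlong (1 : ℂ) (fun w => 𝒞.χ₁ w • g w) x) +
          𝒞.Ψinv x ((J (u₀ x + 𝒞.Ψ x (((0 : ℂ), β) +
              cauchyTransformAlong (1 : ℂ) (fun w => 𝒞.χ₁ w • g w) x)) - J (u₀ x))
            (fderiv ℝ u₀ x Complex.I + (fderiv ℝ 𝒞.Ψ x Complex.I)
              (((0 : ℂ), β) + cauchyTransformAlong (1 : ℂ) (fun w => 𝒞.χ₁ w • g w) x) +
              𝒞.Ψ x (fderiv ℝ (fun y => ((0 : ℂ), β) +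
                cauchyTransformAlong (1 : ℂ) (fun w => 𝒞.χ₁ w • g w) y) x Complex.I)))) := by
  by_cases hχ : 𝒞.χ x = 0
  · simp [VorticityData.G, ContDiffHolderFunction.coeffCLM_apply, hχ]
  have h1 : 𝒞.χ₁ x = 1 := 𝒞.χ₁_eq_one_of_χ_ne_zero hχ
  simp only [VorticityData.G, VorticityData.Φ, VorticityData.N, VorticityData.V₀,
    VorticityData.V₁, ContDiffHolderFunction.coe_add, ContDiffHolderFunction.coe_sub, Pi.add_apply,
    Pi.sub_apply, ContDiffHolderFunction.coeffCLM_apply, app_apply, ContinuousLinearMap.comp_apply,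
    ContDiffHolderFunction.inclCLM_apply, ContDiffHolderFunction.fderivApplyCLM_apply,
    ContDiffHolderFunction.compLeft_apply, coe_W, vorticity_χ, vorticity_J, vorticity_A₁_apply,
    vorticity_Ψ₁_apply, vorticity_dyΨ₁_apply, vorticity_Ψinv₁_apply, vorticity_u₁_apply,
    vorticity_dyu₁_apply, h1, one_smul, one_div, smul_apply, smul_add]

end ChartData

end CoreA

/-- **Registered helper `helper_chartVorticityApply`**: the vorticity map of a chart, pointwise
(the zero equation of the line). -/
theorem helper_chartVorticityApply (J : EuclideanSpace ℝ (Fin 4) → EuclideanSpace ℝ (Fin 4) →L[ℝ]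
      EuclideanSpace ℝ (Fin 4)) (R : ℝ) (P Q : EuclideanSpace ℝ (Fin 4) →L[ℝ] ℂ)
    (eP eQ : ℂ →L[ℝ] EuclideanSpace ℝ (Fin 4)) (hJs : ContDiff ℝ ∞ J)
    {r : ℝ≥0} (hr0 : 0 < r) (hr1 : r < 1)
    (b₀ : ℂ) (u₀ : ℂ → EuclideanSpace ℝ (Fin 4)) (hu₀s : ContDiff ℝ ∞ u₀)
    (𝒞 : CoreA.ChartData J R P Q eP eQ b₀ u₀) (k : ℕ) (β : ℂ)
    (g : ContDiffHolderFunction ℂ (ℂ × ℂ) k r) (x : ℂ) :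
    (𝒞.vorticity hr0 hr1 hJs hu₀s k).G hr1.le (β, g) x =
      g x + 𝒞.χ x • (1 / 2 : ℝ) •
        (𝒞.A x (((0 : ℂ), β) + cauchyTransformAlong (1 : ℂ) (fun w => 𝒞.χ₁ w • g w) x) +
          𝒞.Ψinv x ((J (u₀ x + 𝒞.Ψ x (((0 : ℂ), β) +
              cauchyTransformAlong (1 : ℂ) (fun w => 𝒞.χ₁ w • g w) x)) - J (u₀ x))
            (fderiv ℝ u₀ x Complex.I + (fderiv ℝ 𝒞.Ψ x Complex.I)
              (((0 : ℂ), β) + cauchyTransformAlong (1 : ℂ) (fun w => 𝒞.χ₁ w • g w) x) +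
              𝒞.Ψ x (fderiv ℝ (fun y => ((0 : ℂ), β) +
                cauchyTransformAlong (1 : ℂ) (fun w => 𝒞.χ₁ w • g w) y) x Complex.I)))) :=
  𝒞.G_apply_eq hr0 hr1 hJs hu₀s β g x

end Summit.SmoothPoincare4.SmoothPoincare4.Cruxes.TameOrBrodyR4.Sketch
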